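import Summits.ABC.IUTFork.Repair.RHSigmaCellCredit
import HarnessLib

/-!
# D-0121 T-OPTIMALITY, kernel seat topt-pv-1: «WITHOUT NETTING THE THRESHOLD `T` IS FORCED (c = 1)», what netting buys (`C_σ`), and the
# TIGHTNESS of `T − C_σ` in the information model (LP weak duality with the dual multiplier `λ ≡ 1`)

abc-iut cell, rung LADDER-ABC:A2.RESCUE.H; HUMAN question D-0121 (1) T-OPTIMALITY (21-frontier 2026-08-27T02:03:16Z / 02:09:10Z, «is the ~j² per-cell
weighting FORCED for any derivation of a IV-1.10-type height inequality through the Cor 3.12 shape, or does an on-average-over-labels derivation need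
strictly less identification mass?»); seat text director-abc g4 02:12:06Z «LP weak duality in kernel over the existing SigmaMass / licence decls ⇒ theorem
“any valid averaging scheme needs identification mass ≥ c·T” with c from the dual»; task fixed by abc-iut-rh-lead g3 `plan/rescue/R-H/ROUND3/D0121-SPEC.md`
v0.2 §1.2 (topt-pv-1) and R29 (02:42:43Z): the LIC/none and LIC/netting corners of the information × netting grid. PROOF-ONLY (0 definitions, 0 `Prop`
facts, no instance, no notation); composed BY NAME from abc-iut-rh2-q2-eq's `RHSigmaSignedRemainder` (p480491: `weightedDeficit`, `weightedTrivialMass`,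
THE WEIGHTED DOOR, `statementUpTo_of_weightedDeficit_le`), `RHSigmaCellCredit` (p484504: `weightedTrivialMass_anti`, `weightedTrivialMass_add_compl`),
`RHSigmaLicenceSigned` (p479556: `statementUpTo_iff_signedRemainder_le`) and abc-iut-rh2-w-1 and rh2-T-1's `RHSigmaMass` (p477034: `cellTrivialCost`,
`offTrivialMass`, `onTrivialMass`, `totalTrivialMass`, `massThreshold`, `massThreshold_le_onTrivialMass_iff`); nothing re-typed
(socket sheet: HOME/abc-iut-rh2-T-1/SOCKETS-D0121-T1.md §D; pointer lines rh2-w-1 02:28:08Z, rh2-q2-eq 02:29:32Z).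

CURRENCY (D0121-SPEC §1.0; cells `c = (i, v_ℚ)`, label `j = i+1`; `PN` = procession normalisation): `t(c) = cellTrivialCost P c ≥ 0` (the `(j²−1)`-mass of
the cell), `M = totalTrivialMass P`, `mass(σ) = onTrivialMass P σ`, `B_triv(σᶜ) = offTrivialMass P σ` (the licence-only threshold of record `T(T)` of §1.0 IS
`offTrivialMass P Σ_data`; `massThreshold P tol = M − tol` is MIN-SLICE (ii)'s `T`), `d(c) = cellDeficit`, `D = signedRemainder P = PN Σᶠ d` with
`StatementUpTo P ε ⟺ D ≤ ε`. An AVERAGING SCHEME is a weight `ω : cells → ℝ`, `ω ≤ 1`; its CHARGED mass is `weightedTrivialMass P ω = PN Σᶠ (1−ω)·t`,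
its KEPT mass `weightedTrivialMass P (1−ω) = PN Σᶠ ω·t`; «`ω` is supported on `σ`» (the scheme IDENTIFIES only cells of `σ`) is `ω ≤ 1_σ` cellwise.

WHAT IS PROVED.
* §1 **c = 1 WITHOUT NETTING** (generic, ANY `P : Cor312.Setting S`, bridge hypotheses): `offTrivialMass_le_weightedTrivialMass_of_le_indicator` — a scheme
  supported on `σ` is charged AT LEAST `B_triv(σᶜ)` («identification mass needed ≥ kept mass wanted»: `keptMass_le_onTrivialMass_of_le_indicator`,
  `PN Σᶠ ω·t ≤ mass(σ)`); hence **`massThreshold_le_onTrivialMass_of_weightedTrivialMass_le`**: if such a scheme certifies the tolerance `tol`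
  (`weightedTrivialMass P ω ≤ tol`, the budget the weighted door p480491 hands to the abc ends) then `massThreshold P tol ≤ mass(σ)` — «ANY averaging
  scheme that identifies only the cells of `σ` needs `mass(σ) ≥ T = M − tol`»: the constant of the seat text is `c = 1`, the dual multiplier is `λ ≡ 1`
  (every cell's kept-mass / identification-mass ratio is exactly `1`; R29 «WEIGHTS NEVER MATTER»); [MU]-form `mu_mul_totalTrivialMass_sub_le_onTrivialMass`
  (kept `≥ μ₀·M − A` needs `mass(σ) ≥ μ₀·M − A` — the LP-0 sanity row of D0121-SPEC §1.1: «without netting the j² is the cell's CONTENT, not a weighting»).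
* §2 **WHAT NETTING BUYS, over `P`**: `statementUpTo_onCharge_add_offTrivialMass` — for EVERY stratum `σ`, Cor. 3.12 holds up to
  `PN Σᶠ 1_σ·d + B_triv(σᶜ)` (the weighted door's budget form at `ω = 1_σ`, `δ :=` the signed on-`σ` charge); under the licence on `σ` the on-`σ` charge is
  `−C_σ`, `C_σ := PN Σᶠ 1_σ·(−d)⁺ ≥ 0` the CERTIFIED SURPLUS of `σ` (`weightedDeficit_indicator_eq_neg_onCredit_of_licenceOn`), so
  **`statementUpTo_offTrivialMass_sub_onCredit_of_licenceOn`**: `LicenceOn P σ ⟹ StatementUpTo P (B_triv(σᶜ) − C_σ)` — the LIC/netting corner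
  «netting gains EXACTLY `C_σ`» (R29), and `onCredit_le_credit` (`C_σ ≤ C`).
* §3 **TIGHTNESS = LP DUALITY IN THE INFORMATION MODEL** (namespace `…RH.ToptModel`; a FREE real cell table — labels `Fin l⋆`, any place type, costs
  `t ≥ 0`, certified slacks `s ≥ 0` on `σ`, per-label finite supports — NOT an IUT object, per D0121-SPEC §1.2 «state (ii) as a theorem about the
  real-number model of the cell table, NOT about IUT»). A deficit table `d` is CONSISTENT with the licence-only information {honest cone `d ≤ t`
  everywhere, exact slack `d = −s` on `σ`}; the WORST-CASE table `d⋆ := 1_{σᶜ}·t − 1_σ·s` is consistent (`worstCase_le_cost`, `worstCase_eq_neg_slack`,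
  `worstCase_eq_cost`) and nets to `PN Σᶠ d⋆ = PN Σᶠ 1_{σᶜ}·t − PN Σᶠ 1_σ·s` («`= T − C_σ`», `procNorm_worstCase_eq`). WEAK DUALITY
  (`procNorm_le_of_consistent`): every consistent table nets to `≤ T − C_σ`, so `ε = T − C_σ` IS certified; TIGHTNESS
  (**`sub_le_of_forall_consistent`**): an `ε` certified by EVERY consistent table (which is all a scheme using only that information can appeal to — the
  weighted door's conclusion for any `ω` valid against `d⋆` included) satisfies `T − C_σ ≤ ε`; licence-only WITHOUT the surplus (`d ≤ 0` on `σ` is all that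
  is used): **`le_of_forall_licenceConsistent`**, `T ≤ ε` — the model form of «c = 1». So the least `ε` derivable from {licence on `σ`, honest cone off `σ`,
  certified slack on `σ`} is EXACTLY `T − C_σ`, and from {licence on `σ`, honest cone} EXACTLY `T`: the LIC row of the grid, both nettings, as theorems.
At `P` the typed table `d = cellDeficit` IS consistent (`cellDeficit_le_cellTrivialCost` p480491, `cellDeficit_nonpos_of_licenceOn`), `t = cellTrivialCost`,
`PN Σᶠ 1_{σᶜ}·t = offTrivialMass P σ`: §2 is the model's weak-duality value realised in the kernel currency, §3 says nothing lower follows from that information.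

HONEST FRAMING: bookkeeping inequalities about OUR typed objects and about a free real-number model; «scheme», «certifies», «consistent» are readings of
hypothesis SHAPES, never asserted for any datum; nothing here asserts that abc is proved or refuted, or that [IUTchIII] Cor. 3.12 holds or fails at any
datum, or takes a side on any author (Mochizuki / Scholze–Stix / Joshi / Dupuy–Hilado); the answer «T forced / slack = C_σ» is a statement about OUR typed
currency (D0121-SPEC §1.4), not about print's averaging (topt-rf-1's sheet); typed ≠ proved; computed ≠ proved.
[claim: Mochizuki2012, status: disputed] for every IUT locution. [cite: Mochizuki2012, IUTchIII Cor. 3.12 p. 173–174, Prop. 3.9 (i)(iii) p. 116, Rmk. 3.9.3 p. 119–120]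
-/

noncomputable section

open Set Function

/-! ## §1. c = 1 WITHOUT NETTING: a scheme supported on `σ` is charged at least `B_triv(σᶜ)`, so it needs `mass(σ) ≥ T` -/

namespace Summit.ABC.IUTFork.Repair.RH.SigmaLicence

open Summit.ABC.IUTFork.Thm311 Summit.ABC.IUTFork.Cor312 Summit.ABC.IUTFork.Cor312.Setting Summit.ABC.IUTFork.Cor312Vol
  Literature.IUT.LogThetaLattice Summit.ABC.IUTFork.Repair.RH.SigmaMass

variable {T : ThetaIndex} {S : Situation T} {P : Cor312.Setting S}

/-- **«Identification mass needed ≥ kept mass wanted» (charged form).** Under the bridge hypotheses, a scheme `ω` SUPPORTED ON `σ` (`ω ≤ 1_σ` cellwise: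
weight at most `1` on `σ`, at most `0` off `σ`) is charged at least the off-`σ` trivial mass: `offTrivialMass P σ ≤ weightedTrivialMass P ω`. Two lines over
q2-eq's `weightedTrivialMass_anti` (p484504) and `weightedTrivialMass_indicator` (p480491) — D0121-SPEC §1.2 topt-pv-1 (i). [folklore] -/
theorem offTrivialMass_le_weightedTrivialMass_of_le_indicator (H : BridgeHyps P) {σ : Set (Fin T.lstar × T.VQ)}
    {ω : Fin T.lstar × T.VQ → ℝ} (hω : ∀ c, ω c ≤ σ.indicator (fun _ => (1 : ℝ)) c) :
    offTrivialMass P σ ≤ weightedTrivialMass P ω := by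
  rw [← weightedTrivialMass_indicator σ]
  exact weightedTrivialMass_anti H hω

/-- Support form of the same: `ω ≤ 1` everywhere and `ω ≤ 0` off `σ` ⟹ `offTrivialMass P σ ≤ weightedTrivialMass P ω`. [folklore] -/
theorem offTrivialMass_le_weightedTrivialMass_of_support (H : BridgeHyps P) {σ : Set (Fin T.lstar × T.VQ)}
    {ω : Fin T.lstar × T.VQ → ℝ} (h1 : ∀ c, ω c ≤ 1) (h0 : ∀ c ∉ σ, ω c ≤ 0) :
    offTrivialMass P σ ≤ weightedTrivialMass P ω := by
  refine offTrivialMass_le_weightedTrivialMass_of_le_indicator H fun c => ?_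
  by_cases hc : c ∈ σ
  · rw [Set.indicator_of_mem hc]; exact h1 c
  · rw [Set.indicator_of_notMem hc]; exact h0 c hc

/-- **Kept form: the KEPT `ω`-mass `PN Σᶠ ω·t` of a scheme supported on `σ` is at most `mass(σ)`** (`= onTrivialMass P σ`): with the dual multiplier
`λ ≡ 1` every cell's kept / identified ratio is `1`, so kept `≤` identified. (`charged + kept = M` p484504, `mass(σ) + B_triv(σᶜ) = M` p477034.) [folklore] -/
theorem keptMass_le_onTrivialMass_of_le_indicator (H : BridgeHyps P) {σ : Set (Fin T.lstar × T.VQ)}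
    {ω : Fin T.lstar × T.VQ → ℝ} (hω : ∀ c, ω c ≤ σ.indicator (fun _ => (1 : ℝ)) c) :
    weightedTrivialMass P (fun c => 1 - ω c) ≤ onTrivialMass P σ := by
  have h1 := offTrivialMass_le_weightedTrivialMass_of_le_indicator H hω
  have h2 := weightedTrivialMass_add_compl H ω
  have h3 := onTrivialMass_add_offTrivialMass H σ
  linarith

/-- **THE LICENCE-ONLY LOWER BOUND, `c = 1` (D-0121 (1)(b), no netting): ANY averaging scheme that identifies only the cells of `σ` and certifies the
tolerance `tol` needs `mass(σ) ≥ T = massThreshold P tol`.** Precisely: `ω ≤ 1_σ` cellwise and `weightedTrivialMass P ω ≤ tol` (the budget the weighted door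
p480491 `statementUpTo_weightedTrivialMass_of_weightedDeficit_nonpos` passes to the abc ends) ⟹ `massThreshold P tol ≤ onTrivialMass P σ`. The «c from
the dual» of the seat text is `1`: LP weak duality with the multiplier `λ ≡ 1` on the single budget row (R29 «WEIGHTS NEVER MATTER»). [folklore] -/
theorem massThreshold_le_onTrivialMass_of_weightedTrivialMass_le (H : BridgeHyps P) {σ : Set (Fin T.lstar × T.VQ)}
    {ω : Fin T.lstar × T.VQ → ℝ} (hω : ∀ c, ω c ≤ σ.indicator (fun _ => (1 : ℝ)) c) {tol : ℝ}
    (htol : weightedTrivialMass P ω ≤ tol) : massThreshold P tol ≤ onTrivialMass P σ :=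
  (massThreshold_le_onTrivialMass_iff H σ tol).mpr ((offTrivialMass_le_weightedTrivialMass_of_le_indicator H hω).trans htol)

/-- Support form of the lower bound: `ω ≤ 1`, `ω ≤ 0` off `σ`, `weightedTrivialMass P ω ≤ tol` ⟹ `massThreshold P tol ≤ onTrivialMass P σ`. [folklore] -/
theorem massThreshold_le_onTrivialMass_of_support_of_le (H : BridgeHyps P) {σ : Set (Fin T.lstar × T.VQ)}
    {ω : Fin T.lstar × T.VQ → ℝ} (h1 : ∀ c, ω c ≤ 1) (h0 : ∀ c ∉ σ, ω c ≤ 0) {tol : ℝ}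
    (htol : weightedTrivialMass P ω ≤ tol) : massThreshold P tol ≤ onTrivialMass P σ :=
  (massThreshold_le_onTrivialMass_iff H σ tol).mpr ((offTrivialMass_le_weightedTrivialMass_of_support H h1 h0).trans htol)

/-- **[MU]-form (the LP-0 sanity row of D0121-SPEC §1.1): «kept fraction `μ₀` needs identification mass `≥ μ₀·M`».** If a scheme supported on `σ` keeps
`PN Σᶠ ω·t ≥ μ₀·M − A` (the exponent programme's relative tolerance [MU-C], q2-eq `weightedTrivialMass_le_iff_keptMass_ge`), then `mass(σ) ≥ μ₀·M − A`.
«Without netting the `(j²−1)`-mass is the cell's CONTENT, not a weighting.» [folklore] -/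
theorem mu_mul_totalTrivialMass_sub_le_onTrivialMass (H : BridgeHyps P) {σ : Set (Fin T.lstar × T.VQ)}
    {ω : Fin T.lstar × T.VQ → ℝ} (hω : ∀ c, ω c ≤ σ.indicator (fun _ => (1 : ℝ)) c) {μ₀ A : ℝ}
    (hμ : μ₀ * totalTrivialMass P - A ≤ weightedTrivialMass P (fun c => 1 - ω c)) :
    μ₀ * totalTrivialMass P - A ≤ onTrivialMass P σ :=
  hμ.trans (keptMass_le_onTrivialMass_of_le_indicator H hω)

/-- The same with the charged-mass hypothesis `weightedTrivialMass P ω ≤ (1−μ₀)·M + A` (xi-1's `OffSigmaTolerance (1−μ₀) A` shape on the charged mass).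
[folklore] -/
theorem mu_mul_totalTrivialMass_sub_le_onTrivialMass_of_charged (H : BridgeHyps P) {σ : Set (Fin T.lstar × T.VQ)}
    {ω : Fin T.lstar × T.VQ → ℝ} (hω : ∀ c, ω c ≤ σ.indicator (fun _ => (1 : ℝ)) c) {μ₀ A : ℝ}
    (hch : weightedTrivialMass P ω ≤ (1 - μ₀) * totalTrivialMass P + A) :
    μ₀ * totalTrivialMass P - A ≤ onTrivialMass P σ := by
  refine mu_mul_totalTrivialMass_sub_le_onTrivialMass H hω ?_
  have h := (weightedTrivialMass_le_iff_keptMass_ge H ω (1 - μ₀) A).mp hch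
  rwa [sub_sub_cancel] at h

/-! ## §2. WHAT NETTING BUYS, over `P`: Cor. 3.12 up to `B_triv(σᶜ) − C_σ` under the licence on `σ` -/

/-- `PN (−f) = −PN f`. [folklore] -/
theorem processionNormalized_neg {lstar : ℕ} (f : Fin lstar → ℝ) :
    processionNormalized (fun i => -f i) = -processionNormalized f := by
  unfold processionNormalized
  rw [Finset.sum_neg_distrib, neg_div]

/-- **Netting, budget form, for EVERY stratum**: Cor. 3.12 holds up to «signed on-`σ` charge `+ B_triv(σᶜ)`», i.e.
`StatementUpTo P (weightedDeficit P 1_σ + offTrivialMass P σ)` — the weighted door's budget form `statementUpTo_of_weightedDeficit_le` (p480491) at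
`ω = 1_σ`, `δ :=` the on-`σ` charge itself; no licence needed. [claim: Mochizuki2012, status: disputed] -/
theorem statementUpTo_onCharge_add_offTrivialMass (H : BridgeHyps P) (σ : Set (Fin T.lstar × T.VQ)) :
    StatementUpTo P (weightedDeficit P (σ.indicator fun _ => (1 : ℝ)) + offTrivialMass P σ) := by
  have h := statementUpTo_of_weightedDeficit_le H (ω := σ.indicator fun _ => (1 : ℝ)) (fun c => ?_) le_rfl
  · rwa [weightedTrivialMass_indicator] at h
  · by_cases hc : c ∈ σ
    · rw [Set.indicator_of_mem hc]
    · rw [Set.indicator_of_notMem hc]; exact zero_le_one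

/-- Per label, the on-`σ` surplus `1_σ·(−d)⁺` is finitely supported over `v_ℚ`. [folklore] -/
theorem indicator_negDeficit_pos_support_finite (H : BridgeHyps P) (σ : Set (Fin T.lstar × T.VQ)) (i : Fin T.lstar) :
    (Function.support fun vQ : T.VQ =>
      σ.indicator (fun c : Fin T.lstar × T.VQ => max (-cellDeficit P c.1 c.2) 0) (i, vQ)).Finite := by
  refine (cellDeficit_support_finite H i).subset fun vQ hv => ?_
  rw [Function.mem_support] at hv ⊢
  intro h0
  refine hv (Set.indicator_apply_eq_zero.2 fun _ => ?_)
  rw [h0, neg_zero, max_self]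

/-- **Under the licence on `σ` the signed on-`σ` charge is MINUS the certified surplus of `σ`**: `weightedDeficit P 1_σ = −C_σ`,
`C_σ := PN Σᶠ 1_σ·(−cellDeficit)⁺` (each licensed cell has `d ≤ 0`, so `d = −(−d)⁺`). [claim: Mochizuki2012, status: disputed] -/
theorem weightedDeficit_indicator_eq_neg_onCredit_of_licenceOn (H : BridgeHyps P) {σ : Set (Fin T.lstar × T.VQ)} (hσ : LicenceOn P σ) :
    weightedDeficit P (σ.indicator fun _ => (1 : ℝ)) =
      -processionNormalized fun i : Fin T.lstar => ∑ᶠ vQ : T.VQ,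
        σ.indicator (fun c : Fin T.lstar × T.VQ => max (-cellDeficit P c.1 c.2) 0) (i, vQ) := by
  rw [weightedDeficit_indicator, ← processionNormalized_neg]
  refine congrArg processionNormalized (funext fun i => ?_)
  rw [← finsum_neg_distrib]
  refine finsum_congr fun vQ => ?_
  by_cases hc : (i, vQ) ∈ σ
  · rw [Set.indicator_of_mem hc, Set.indicator_of_mem hc, max_eq_left (neg_nonneg.mpr (cellDeficit_nonpos_of_licenceOn H hσ hc)), neg_neg]
  · rw [Set.indicator_of_notMem hc, Set.indicator_of_notMem hc, neg_zero]

/-- `C_σ ≥ 0`: the certified surplus of a stratum is non-negative. [folklore] -/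
theorem onCredit_nonneg (σ : Set (Fin T.lstar × T.VQ)) :
    0 ≤ processionNormalized fun i : Fin T.lstar => ∑ᶠ vQ : T.VQ,
      σ.indicator (fun c : Fin T.lstar × T.VQ => max (-cellDeficit P c.1 c.2) 0) (i, vQ) :=
  processionNormalized_nonneg fun _ => finsum_nonneg fun _ => Set.indicator_nonneg (fun _ _ => le_max_right _ _) _

/-- `C_σ ≤ C`: the surplus of a stratum is at most the total credit `credit P = PN Σᶠ (−d)⁺` (p480491). [folklore] -/
theorem onCredit_le_credit (H : BridgeHyps P) (σ : Set (Fin T.lstar × T.VQ)) :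
    (processionNormalized fun i : Fin T.lstar => ∑ᶠ vQ : T.VQ,
      σ.indicator (fun c : Fin T.lstar × T.VQ => max (-cellDeficit P c.1 c.2) 0) (i, vQ)) ≤ credit P := by
  unfold credit processionNormalized
  refine div_le_div_of_nonneg_right (Finset.sum_le_sum fun i _ => ?_) (Nat.cast_nonneg _)
  have hfull : (Function.support fun vQ : T.VQ => max (-cellDeficit P i vQ) 0).Finite := by
    refine (cellDeficit_support_finite H i).subset fun vQ hv => ?_
    rw [Function.mem_support] at hv ⊢
    intro h0
    exact hv (by rw [h0, neg_zero, max_self])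
  refine finsum_le_finsum' (indicator_negDeficit_pos_support_finite H σ i) hfull fun vQ => ?_
  exact Set.indicator_le_self' (fun _ _ => le_max_right _ _) (i, vQ)

/-- **THE LIC/NETTING CORNER over `P` (R29 «netting gains EXACTLY `C_σ`», achievability side): `LicenceOn P σ ⟹ StatementUpTo P (B_triv(σᶜ) − C_σ)`**
— the licence on `σ`, netted through the ONE procession-normalised average, certifies Cor. 3.12 up to the off-`σ` trivial mass MINUS the certified surplus
of `σ` (rh2-w-1's `statementUpTo_offTrivialMass_of_licenceOn` is the `C_σ ≥ 0` weakening). «follows AS TYPED».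
[cite: Mochizuki2012, IUTchIII Cor. 3.12 p. 173–174] [claim: Mochizuki2012, status: disputed] -/
theorem statementUpTo_offTrivialMass_sub_onCredit_of_licenceOn (H : BridgeHyps P) {σ : Set (Fin T.lstar × T.VQ)} (hσ : LicenceOn P σ) :
    StatementUpTo P (offTrivialMass P σ -
      processionNormalized fun i : Fin T.lstar => ∑ᶠ vQ : T.VQ,
        σ.indicator (fun c : Fin T.lstar × T.VQ => max (-cellDeficit P c.1 c.2) 0) (i, vQ)) := by
  have h := statementUpTo_onCharge_add_offTrivialMass H σ
  rw [weightedDeficit_indicator_eq_neg_onCredit_of_licenceOn H hσ] at h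
  rwa [sub_eq_neg_add]

/-- Signed-remainder form of the corner: under the licence on `σ`, `D ≤ B_triv(σᶜ) − C_σ`. [claim: Mochizuki2012, status: disputed] -/
theorem signedRemainder_le_offTrivialMass_sub_onCredit_of_licenceOn (H : BridgeHyps P) {σ : Set (Fin T.lstar × T.VQ)}
    (hσ : LicenceOn P σ) :
    signedRemainder P ≤ offTrivialMass P σ -
      processionNormalized fun i : Fin T.lstar => ∑ᶠ vQ : T.VQ,
        σ.indicator (fun c : Fin T.lstar × T.VQ => max (-cellDeficit P c.1 c.2) 0) (i, vQ) :=
  (statementUpTo_iff_signedRemainder_le H _).mp (statementUpTo_offTrivialMass_sub_onCredit_of_licenceOn H hσ)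

end Summit.ABC.IUTFork.Repair.RH.SigmaLicence

/-! ## §3. TIGHTNESS — LP duality in the INFORMATION MODEL (a free real cell table; NOT an IUT object) -/

namespace Summit.ABC.IUTFork.Repair.RH.ToptModel

open Literature.IUT.LogThetaLattice Summit.ABC.IUTFork.Repair.RH.SigmaLicence

variable {lstar : ℕ} {V : Type*}

/-- In the model, the WORST-CASE table `d⋆ = 1_{σᶜ}·t − 1_σ·s` obeys the honest cone `d⋆ ≤ t` (costs `t ≥ 0`, slacks `s ≥ 0`). [folklore] -/
theorem worstCase_le_cost (σ : Set (Fin lstar × V)) {t s : Fin lstar × V → ℝ} (ht : ∀ c, 0 ≤ t c) (hs : ∀ c, 0 ≤ s c)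
    (c : Fin lstar × V) : σᶜ.indicator t c - σ.indicator s c ≤ t c := by
  by_cases hc : c ∈ σ
  · rw [Set.indicator_of_notMem (Set.notMem_compl_iff.mpr hc), Set.indicator_of_mem hc]
    linarith [ht c, hs c]
  · rw [Set.indicator_of_mem (Set.mem_compl hc), Set.indicator_of_notMem hc, sub_zero]

/-- On `σ` the worst-case table IS the certified slack: `d⋆ = −s` (so `d⋆ ≤ 0` there: the licence). [folklore] -/
theorem worstCase_eq_neg_slack (σ : Set (Fin lstar × V)) (t s : Fin lstar × V → ℝ) {c : Fin lstar × V} (hc : c ∈ σ) :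
    σᶜ.indicator t c - σ.indicator s c = -s c := by
  rw [Set.indicator_of_notMem (Set.notMem_compl_iff.mpr hc), Set.indicator_of_mem hc, zero_sub]

/-- Off `σ` the worst-case table IS the trivial cost: `d⋆ = t` (the cone is attained). [folklore] -/
theorem worstCase_eq_cost (σ : Set (Fin lstar × V)) (t s : Fin lstar × V → ℝ) {c : Fin lstar × V} (hc : c ∉ σ) :
    σᶜ.indicator t c - σ.indicator s c = t c := by
  rw [Set.indicator_of_mem (Set.mem_compl hc), Set.indicator_of_notMem hc, sub_zero]

/-- On `σ` the worst-case table is `≤ 0` when `s ≥ 0`. [folklore] -/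
theorem worstCase_nonpos_of_mem (σ : Set (Fin lstar × V)) (t : Fin lstar × V → ℝ) {s : Fin lstar × V → ℝ} (hs : ∀ c, 0 ≤ s c)
    {c : Fin lstar × V} (hc : c ∈ σ) : σᶜ.indicator t c - σ.indicator s c ≤ 0 := by
  rw [worstCase_eq_neg_slack σ t s hc]
  exact neg_nonpos.mpr (hs c)

/-- Per label, an indicator-restricted family inherits finite support. [folklore] -/
theorem indicator_row_support_finite (σ : Set (Fin lstar × V)) {f : Fin lstar × V → ℝ} {i : Fin lstar}
    (hf : (Function.support fun v : V => f (i, v)).Finite) :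
    (Function.support fun v : V => σ.indicator f (i, v)).Finite := by
  refine hf.subset fun v hv => ?_
  rw [Function.mem_support] at hv ⊢
  exact fun h0 => hv (Set.indicator_apply_eq_zero.2 fun _ => h0)

/-- Per label, the worst-case table is finitely supported. [folklore] -/
theorem worstCase_row_support_finite (σ : Set (Fin lstar × V)) {t s : Fin lstar × V → ℝ} {i : Fin lstar}
    (ht : (Function.support fun v : V => t (i, v)).Finite) (hs : (Function.support fun v : V => s (i, v)).Finite) :
    (Function.support fun v : V => σᶜ.indicator t (i, v) - σ.indicator s (i, v)).Finite :=
  ((indicator_row_support_finite σᶜ ht).union (indicator_row_support_finite σ hs)).subset (Function.support_sub _ _)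

/-- **The worst-case table nets to `T − C_σ`**: `PN Σᶠ d⋆ = PN Σᶠ 1_{σᶜ}·t − PN Σᶠ 1_σ·s` (off-`σ` trivial mass minus on-`σ` certified surplus).
[folklore] -/
theorem procNorm_worstCase_eq (σ : Set (Fin lstar × V)) {t s : Fin lstar × V → ℝ}
    (ht : ∀ i : Fin lstar, (Function.support fun v : V => t (i, v)).Finite)
    (hs : ∀ i : Fin lstar, (Function.support fun v : V => s (i, v)).Finite) :
    processionNormalized (fun i : Fin lstar => ∑ᶠ v : V, (σᶜ.indicator t (i, v) - σ.indicator s (i, v))) =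
      processionNormalized (fun i : Fin lstar => ∑ᶠ v : V, σᶜ.indicator t (i, v)) -
        processionNormalized (fun i : Fin lstar => ∑ᶠ v : V, σ.indicator s (i, v)) := by
  rw [← processionNormalized_sub]
  refine congrArg processionNormalized (funext fun i => ?_)
  exact finsum_sub_distrib (indicator_row_support_finite σᶜ (ht i)) (indicator_row_support_finite σ (hs i))

/-- **WEAK DUALITY in the model (the value `T − C_σ` IS certified): every table CONSISTENT with the licence-only information — honest cone `d ≤ t`
everywhere, `d ≤ −s` on `σ` (certified slack at least `s`) — nets to `PN Σᶠ d ≤ PN Σᶠ 1_{σᶜ}·t − PN Σᶠ 1_σ·s`.** (Dual multiplier `1` on every cell.) [folklore] -/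
theorem procNorm_le_of_consistent (σ : Set (Fin lstar × V)) {t s d : Fin lstar × V → ℝ}
    (ht : ∀ i : Fin lstar, (Function.support fun v : V => t (i, v)).Finite)
    (hs : ∀ i : Fin lstar, (Function.support fun v : V => s (i, v)).Finite)
    (hd : ∀ i : Fin lstar, (Function.support fun v : V => d (i, v)).Finite)
    (hcone : ∀ c, d c ≤ t c) (hslack : ∀ c ∈ σ, d c ≤ -s c) :
    processionNormalized (fun i : Fin lstar => ∑ᶠ v : V, d (i, v)) ≤
      processionNormalized (fun i : Fin lstar => ∑ᶠ v : V, σᶜ.indicator t (i, v)) -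
        processionNormalized (fun i : Fin lstar => ∑ᶠ v : V, σ.indicator s (i, v)) := by
  rw [← procNorm_worstCase_eq σ ht hs]
  unfold processionNormalized
  refine div_le_div_of_nonneg_right (Finset.sum_le_sum fun i _ => ?_) (Nat.cast_nonneg _)
  refine finsum_le_finsum' (hd i) (worstCase_row_support_finite σ (ht i) (hs i)) fun v => ?_
  by_cases hc : (i, v) ∈ σ
  · rw [worstCase_eq_neg_slack σ t s hc]; exact hslack _ hc
  · rw [worstCase_eq_cost σ t s hc]; exact hcone _

/-- **TIGHTNESS (D0121-SPEC §1.2 topt-pv-1 (ii); the LIC/netting corner is the FLOOR): if `ε` is certified by EVERY consistent table — i.e. every deficit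
table with `d ≤ t` everywhere and `d = −s` on `σ` nets to `≤ ε` — then `PN Σᶠ 1_{σᶜ}·t − PN Σᶠ 1_σ·s ≤ ε`.** So NO scheme using only {licence on `σ`,
honest cone off `σ`, certified slack on `σ`} certifies `StatementUpTo ε` for an `ε < T − C_σ`: the worst-case table `d⋆` is consistent and nets to exactly
`T − C_σ`. A statement about the real-number model of the cell table, NOT about IUT. [folklore] -/
theorem sub_le_of_forall_consistent (σ : Set (Fin lstar × V)) {t s : Fin lstar × V → ℝ} (ht0 : ∀ c, 0 ≤ t c) (hs0 : ∀ c, 0 ≤ s c)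
    (ht : ∀ i : Fin lstar, (Function.support fun v : V => t (i, v)).Finite)
    (hs : ∀ i : Fin lstar, (Function.support fun v : V => s (i, v)).Finite) {ε : ℝ}
    (hcert : ∀ d : Fin lstar × V → ℝ, (∀ i : Fin lstar, (Function.support fun v : V => d (i, v)).Finite) →
      (∀ c, d c ≤ t c) → (∀ c ∈ σ, d c = -s c) →
        processionNormalized (fun i : Fin lstar => ∑ᶠ v : V, d (i, v)) ≤ ε) :
    processionNormalized (fun i : Fin lstar => ∑ᶠ v : V, σᶜ.indicator t (i, v)) -
        processionNormalized (fun i : Fin lstar => ∑ᶠ v : V, σ.indicator s (i, v)) ≤ ε := by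
  rw [← procNorm_worstCase_eq σ ht hs]
  exact hcert (fun c => σᶜ.indicator t c - σ.indicator s c) (fun i => worstCase_row_support_finite σ (ht i) (hs i))
    (worstCase_le_cost σ ht0 hs0) (fun c hc => worstCase_eq_neg_slack σ t s hc)

/-- **Hence the least certified `ε` is EXACTLY `T − C_σ`** (weak duality ∧ tightness): `T − C_σ ≤ ε ⟺` every consistent table nets to `≤ ε`. [folklore] -/
theorem sub_le_iff_forall_consistent (σ : Set (Fin lstar × V)) {t s : Fin lstar × V → ℝ} (ht0 : ∀ c, 0 ≤ t c) (hs0 : ∀ c, 0 ≤ s c)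
    (ht : ∀ i : Fin lstar, (Function.support fun v : V => t (i, v)).Finite)
    (hs : ∀ i : Fin lstar, (Function.support fun v : V => s (i, v)).Finite) (ε : ℝ) :
    processionNormalized (fun i : Fin lstar => ∑ᶠ v : V, σᶜ.indicator t (i, v)) -
        processionNormalized (fun i : Fin lstar => ∑ᶠ v : V, σ.indicator s (i, v)) ≤ ε ↔
      ∀ d : Fin lstar × V → ℝ, (∀ i : Fin lstar, (Function.support fun v : V => d (i, v)).Finite) →
        (∀ c, d c ≤ t c) → (∀ c ∈ σ, d c = -s c) →
          processionNormalized (fun i : Fin lstar => ∑ᶠ v : V, d (i, v)) ≤ ε := by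
  refine ⟨fun h d hd hcone hslack => ?_, sub_le_of_forall_consistent σ ht0 hs0 ht hs⟩
  exact (procNorm_le_of_consistent σ ht hs hd hcone fun c hc => (hslack c hc).le).trans h

/-- **LICENCE-ONLY, NO SURPLUS USED — the model form of «c = 1»**: if `ε` is certified by every table with `d ≤ t` everywhere and `d ≤ 0` on `σ` (the
licence on `σ` and the honest cone, nothing else), then `PN Σᶠ 1_{σᶜ}·t ≤ ε` — the off-`σ` trivial mass `T` itself is the floor (witness: `d = 1_{σᶜ}·t`).
[folklore] -/
theorem le_of_forall_licenceConsistent (σ : Set (Fin lstar × V)) {t : Fin lstar × V → ℝ} (ht0 : ∀ c, 0 ≤ t c)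
    (ht : ∀ i : Fin lstar, (Function.support fun v : V => t (i, v)).Finite) {ε : ℝ}
    (hcert : ∀ d : Fin lstar × V → ℝ, (∀ i : Fin lstar, (Function.support fun v : V => d (i, v)).Finite) →
      (∀ c, d c ≤ t c) → (∀ c ∈ σ, d c ≤ 0) →
        processionNormalized (fun i : Fin lstar => ∑ᶠ v : V, d (i, v)) ≤ ε) :
    processionNormalized (fun i : Fin lstar => ∑ᶠ v : V, σᶜ.indicator t (i, v)) ≤ ε := by
  refine hcert (σᶜ.indicator t) (fun i => indicator_row_support_finite σᶜ (ht i)) (fun c => ?_) (fun c hc => ?_)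
  · exact Set.indicator_le_self' (fun _ _ => ht0 _) c
  · rw [Set.indicator_of_notMem (Set.notMem_compl_iff.mpr hc)]

/-- Conversely every licence-consistent table nets to `≤ PN Σᶠ 1_{σᶜ}·t` (the `s = 0` case of weak duality), so the licence-only least certified `ε`
is EXACTLY `T`: `T ≤ ε ⟺` every licence-consistent table nets to `≤ ε`. [folklore] -/
theorem le_iff_forall_licenceConsistent (σ : Set (Fin lstar × V)) {t : Fin lstar × V → ℝ} (ht0 : ∀ c, 0 ≤ t c)
    (ht : ∀ i : Fin lstar, (Function.support fun v : V => t (i, v)).Finite) (ε : ℝ) :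
    processionNormalized (fun i : Fin lstar => ∑ᶠ v : V, σᶜ.indicator t (i, v)) ≤ ε ↔
      ∀ d : Fin lstar × V → ℝ, (∀ i : Fin lstar, (Function.support fun v : V => d (i, v)).Finite) →
        (∀ c, d c ≤ t c) → (∀ c ∈ σ, d c ≤ 0) →
          processionNormalized (fun i : Fin lstar => ∑ᶠ v : V, d (i, v)) ≤ ε := by
  refine ⟨fun h d hd hcone hlic => ?_, le_of_forall_licenceConsistent σ ht0 ht⟩
  have hz : ∀ c, σ.indicator (fun _ : Fin lstar × V => (0 : ℝ)) c = 0 := fun c => Set.indicator_apply_eq_zero.2 fun _ => rfl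
  have h0 := procNorm_le_of_consistent σ (s := fun _ => 0) ht (fun _ => by simp) hd hcone
    (fun c hc => by rw [neg_zero]; exact hlic c hc)
  simp only [hz, finsum_zero, processionNormalized_zero, sub_zero] at h0
  exact h0.trans h

end Summit.ABC.IUTFork.Repair.RH.ToptModel

end
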